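/-
Origin: expansion seat `prover-pub-hodgecm-mc-binder-1-g18-0`, handover #R124 2026-08-20T23:58:36Z md5 31cb33de644d (361 l.; NEW additive MODEL leaf, ns HodgeCM.Model.ThetaAdelicSide.ThetaDistDatum ∕ HodgeCM.Model.ThetaAdelicSide; imports #R123 (this kit) + INSTALLED #1251 Model/AdelicThetaDistributionEnd (RUN 66) + INSTALLED #CA27 Model/ArchKTypeOfDefiniteChar (RUN 43); install AFTER #R123; drop-alone below it; 0 records, 0 `def … : Prop`, two data defs (`archOpZero/One`, linear operators), nothing cited; `Φarch ≠ 0` of the rank-form wrappers is discharged at the pin by PKG `ArchSideTerm.blockFamilyOfAt_degOnePDual_binvPi_one_ne_zero` (Model/ArchLineDatumOf); cert lean-direct over the RUN-66 PKG oleans mirror (4 541) rc 0 ∕ 0 warn ∕ 0 proof-hole 44 s, `#print axioms` 12 ∕ 12 trio (`farm/logs/ax_multend.log`), FQN grep vs PKG 0 collisions ∕ 0 homonyms; NAMES for audit: HodgeCM.Model.ThetaAdelicSide.ThetaDistDatum.clsU_mem_iSup_block_of_mem_holSat_of_multOne · HodgeCM.Model.ThetaAdelicSide.archSideOf_ω_zero_regime_archToAdelic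 · HodgeCM.Model.ThetaAdelicSide.clsU_mem_iSup_block_of_mem_holSat_archSideOf_zero; NAME LIST: HodgeCM.Model.ThetaAdelicSide.ThetaDistDatum.clsU_mem_iSup_block_of_mem_holSat_of_multOne · HodgeCM.Model.ThetaAdelicSide.archSideOf_ω_zero_regime_archToAdelic · HodgeCM.Model.ThetaAdelicSide.clsU_mem_iSup_block_of_mem_holSat_archSideOf_zero; all decls: HodgeCM.Model.ThetaAdelicSide.ThetaDistDatum.clsU_mem_iSup_block_of_mem_adelicThetaSpanSat_of_multOne · HodgeCM.Model.ThetaAdelicSide.ThetaDistDatum.clsU_mem_iSup_block_of_mem_holSat_of_multOne · HodgeCM.Model.ThetaAdelicSide.archOpZero (def, linear operator) · HodgeCM.Model.ThetaAdelicSide.archOpOne (def, linear operator) · HodgeCM.Model.ThetaAdelicSide.archSideOf_ω_zero_regime_archToAdelic · HodgeCM.Model.ThetaAdelicSide.archSideOf_ω_one_regime_archToAdelic · HodgeCM.Model.ThetaAdelicSide.exists_eq_dist_of_mem_holSat_archSideOf_zero · HodgeCM.Model.ThetaAdelicSide.exists_eq_dist_of_mem_holSat_archSideOf_one · HodgeCM.Model.ThetaAdelicSide.clsU_mem_iSup_block_of_mem_holSat_archSideOf_zero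 · HodgeCM.Model.ThetaAdelicSide.clsU_mem_iSup_block_of_mem_holSat_archSideOf_one · HodgeCM.Model.ThetaAdelicSide.clsU_mem_iSup_block_of_mem_holSat_archSideOf_zero_of_rank_le_one · HodgeCM.Model.ThetaAdelicSide.clsU_mem_iSup_block_of_mem_holSat_archSideOf_one_of_rank_le_one) (`HOME/mc/pub-hodgecm-mc-binder-1-g18/stage67/HodgeCM/Model/AdelicThetaDistributionMultEnd.lean`, md5 31cb33de644d, 361 lines);
landed by the gen-28 packager (p-g28) in gate run 67 as `HodgeCM/Model/AdelicThetaDistributionMultEnd.lean` (verbatim).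
-/
/-
Copyright (c) 2026 the pub-hodgecm formalisation cell (harness21).  New file, not vendored.
Origin: session prover-pub-hodgecm-mc-binder-1-g18-0 (unit pub-hodgecm-mc-binder-1-g18, BINDER PROVER gen 18; the (J4-mult1) ALGEBRA leaf composed
with sinst-1's block membership: `hfam` clause 2 for EVERY theta form of the slot, generic and at the honest adelic side `archSideOf …`,
slots 0 and 1), 2026-08-20.
Intended final place: `HodgeCM/Model/AdelicThetaDistributionMultEnd.lean` (NEW additive model-layer leaf; imports binder-1's
`HodgeCM.Model.AdelicThetaDistributionMult` (#R123), sinst-1's `HodgeCM.Model.AdelicThetaDistributionEnd` (#1251) and carch's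
`HodgeCM.Model.ArchKTypeOfDefiniteChar` (#CA27); nothing imports it; drop alone).
-/
import Summits.HodgeConjecture.HodgeCM.Model.AdelicThetaDistributionMult_2
import Summits.HodgeConjecture.HodgeCM.Model.AdelicThetaDistributionEnd
import Summits.HodgeConjecture.HodgeCM.Model.ArchKTypeOfDefiniteChar

set_option autoImplicit false

/-!
# `hfam` clause 2 for every theta form of the slot, modulo multiplicity one

* § 1 (generic `D : S.ThetaDistDatum hV k`) **`clsU_mem_iSup_block_of_mem_adelicThetaSpanSat_of_multOne`**: modulo the (J4-mult1) input
  (`hmult`, over the archimedean operator datum `ωar`/`har` of #R123), EVERY element `F` of the `satG hV K`-saturated adèlic theta module of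
  the slot with weight functions `𝓕 ⊆ {charInv χ}` lies in `holSatU` and its tower class `clsU ⟨F, _⟩` lies in
  `⨆_{χ, charInv χ ∈ 𝓕} ⨆ ψ : Ω(χ) →ₗ[ℂ[U(V)(𝔸_f)]] Tower, range ψ` — #R123 `adelicThetaSpanSat_le_span_dist` (the module is spanned by the
  values `D.dist f Φ_f`) + #1248 `exists_mem_holSatU_clsU_mem_block` (each value's class lies in the block of `Ω(χ)`) + linearity of `clsU`;
  `…_of_mem_holSat…` for sinst-1's `holSat Γ`;
* § 2 (the honest side) the archimedean operators **`archOpZero/One … aa := cₖ(aa′) • ω_∞(aa′, 1)`** of slots 0/1 with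
  **`har` DISCHARGED** by carch's `lineRepOf_zero/one_regime_archToAdelicG` (#CA27), and the § 1 statement at
  `S := archSideOf …`, `D := thetaDistDatumZeroOf/OneOf …` (#1250) with `hGfin`/`hLF` discharged as in #1251: hypotheses left = #CA61's
  `Φarch`/`harm`/`hdef`, E's (AN)/(REP′) `hd`/`hCR`, `hι`, and the ONE multiplicity-one input
  `hmult : ∀ a ∈ (thetaDistDatumZeroOf …).admFamilies (archOpZero …), ∃ r, a = r • Φarch` (family form; from the RANK form
  `Module.rank ℂ ↥(admFamilies …) ≤ 1` + `Φarch ≠ 0` by #R123 `multOne_of_rank_le_one` — `…_of_rank_le_one` variants).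
KERNEL only: two data `def`s (linear operators), 0 records, 0 `def … : Prop`, nothing cited; `#print axioms` ⊆ {propext, Classical.choice, Quot.sound}.
-/

noncomputable section

open MeasureTheory MulAction IsDedekindDomain NumberField.mixedEmbedding
open NumberField hiding relNormOneIdeles relNormOneRat probHaarRelNormOneQuot
open scoped Matrix TensorProduct Classical SchwartzMap
open Literature.NumberTheory.Automorphic Literature.NumberTheory.Automorphic.UnitaryGroup Literature.NumberTheory.Weil1964
open Literature.NumberTheory.GelbartRogawski1991 Literature.NumberTheory.GelbartRogawski1991.UnitaryDualPair
open Literature.Geometry.ComplexHyperbolic.BallModel (U21 x₀)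
open Literature.AlgebraicGeometry.HodgeTheory Literature.AlgebraicGeometry.ShimuraVarieties
open Literature.NumberTheory.Automorphic.PicardCM
open Literature.NumberTheory.Transcendental (Arapura2012_Cor_15_4_6)
open HodgeCM.Adelic HodgeCM.PerL34 HodgeCM.Model.HypCensus HodgeCM.Model.ArchSideTerm HodgeCM.Model.ThetaDistFin HodgeCM.Model.TowerCarrier
open HodgeCM.Model.SupplyInstance HodgeCM.Model.SupplyResidual HodgeCM.Model.ThetaSpace
open HodgeCM.Model.SupplyResidual.WeilPairData (charInv)

namespace HodgeCM.Model
namespace ThetaAdelicSide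

/-! ### § 1. Generic: the tower class of every saturated theta form lies in the sum of the blocks -/

namespace ThetaDistDatum

variable (hHD : exists_isReal_hodgeModel) (hI : hodgePQ_independent_of_hodgeModel)
  (h₁ : BallQuotientUniformised) (h₃ : CMAbelianVarietyRealised) (hA : Arapura2012_Cor_15_4_6)
variable {L : CMField} {ι₁ : L →+* ℂ} {V : HermSpace3 L ι₁} {c : SeesawCtx L}
variable {S : ThetaAdelicSide V c} {hV : IsAnisotropic L V.Hm} {k : Fin 4} (D : S.ThetaDistDatum hV k)
variable (ωar : UnitaryGroup.arch (↥(maximalRealSubfield L)) L (IsCMField.complexConj L) 3 V.Hm →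
    (𝓢((Fin 3 → mixedSpace (↥(maximalRealSubfield L))), ℂ) →ₗ[ℂ] 𝓢((Fin 3 → mixedSpace (↥(maximalRealSubfield L))), ℂ)))
  (har : ∀ aa : UnitaryGroup.arch (↥(maximalRealSubfield L)) L (IsCMField.complexConj L) 3 V.Hm,
      UnitaryGroup.archAt (↥(maximalRealSubfield L)) L (IsCMField.complexConj L) 3 V.Hm (UnitaryGroup.cmPlace (L : Type) ι₁)
          (NumberField.complexConj_smul_infinitePlace (L : Type) _) (IsCMField.complexConj_ne_one (L : Type)) aa = 1 →
      (S.P k).ω (HodgeCM.Adelic.regimeEquiv L V.Hm hV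
          (UnitaryGroup.archToAdelic (↥(maximalRealSubfield L)) L (IsCMField.complexConj L) 3 V.Hm aa), 1) =
        adelicTensorEnd (K := ↥(maximalRealSubfield L)) (ι := Fin 3) (ωar aa) LinearMap.id)
  (hmult : ∀ a ∈ D.admFamilies ωar, ∃ r : ℂ, a = r • D.Φarch)
variable (hGfin : ∀ K : Subgroup ↥V.adelicFin, satG hV K ≤ S.Gfin) (hLF : (S.P k).IsLFAction)
  (hd : ∀ (T : 𝓢((Fin 3 → mixedSpace (↥(maximalRealSubfield L))), ℂ) →L[ℂ] ℂ) (ℓ : Module.Dual ℂ (Fin 2 → ℂ)),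
    DifferentiableAt ℝ (fun b => T (D.ωA (BallForms.expP b) (D.Φarch ℓ))) 0)
  (hCR : ∀ (T : 𝓢((Fin 3 → mixedSpace (↥(maximalRealSubfield L))), ℂ) →L[ℂ] ℂ) (ℓ : Module.Dual ℂ (Fin 2 → ℂ)) (v : Fin 2 → ℂ),
    fderiv ℝ (fun b => T (D.ωA (BallForms.expP b) (D.Φarch ℓ))) 0 (Complex.I • v) =
      Complex.I • fderiv ℝ (fun b => T (D.ωA (BallForms.expP b) (D.Φarch ℓ))) 0 v)
  {𝓕 : Set C(↥(relNormOneIdeles (↥(maximalRealSubfield L)) L) ⧸ relNormOneRat (↥(maximalRealSubfield L)) L, ℂ)}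
  (h𝓕 : ∀ f ∈ 𝓕, ∃ χ : PontryaginDual (↥(relNormOneIdeles (↥(maximalRealSubfield L)) L) ⧸ relNormOneRat (↥(maximalRealSubfield L)) L),
    f = charInv χ)

include har hmult hGfin hLF hd hCR h𝓕 in
/-- **`hfam` clause 2 for EVERY saturated theta form of the slot (modulo multiplicity one).**  For weight functions `𝓕 ⊆ {charInv χ}`,
every element `F` of the `satG hV K`-saturated adèlic theta module of the slot lies in `holSatU` and its tower class lies in the sum over
the characters `χ` with `charInv χ ∈ 𝓕` of the blocks of Liu's modules `Ω(χ)`. -/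
theorem clsU_mem_iSup_block_of_mem_adelicThetaSpanSat_of_multOne (hι : S.ιinf = archInfOf V) (K : Subgroup ↥V.adelicFin)
    {F : (V.latticeModel printFact_unitaryCompact_holds).G → (Fin 2 → ℂ)}
    (hF : F ∈ adelicThetaSpanSat (S.P k) S.ιinf (stabilizer U21 x₀).subtype (BallForms.isPullbackCocycle_cotangentCocycle.weightOf x₀)
      (satG hV K) 𝓕) :
    ∃ hF' : F ∈ S.holSatU hV k 𝓕,
      S.clsU hHD hI h₁ h₃ hA 𝓕 hι hV k ⟨F, hF'⟩ ∈
        ⨆ (χ : PontryaginDual (↥(relNormOneIdeles (↥(maximalRealSubfield L)) L) ⧸ relNormOneRat (↥(maximalRealSubfield L)) L))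
          (_ : charInv χ ∈ 𝓕),
          ⨆ ψ : (D.coinvRep χ).asModule →ₗ[MonoidAlgebra ℂ ↥V.adelicFin] Tower hHD hI (ballQuotientUniformisedDatum_of h₁) h₃ hA V,
            (LinearMap.range ψ).restrictScalars ℂ := by
  have key : ∀ F' ∈ Submodule.span ℂ {F' | ∃ f ∈ 𝓕, ∃ Φf : FinSB (↥(maximalRealSubfield L)) (Fin 3),
      (∀ g ∈ K, D.ωf (g, 1) Φf = Φf) ∧ F' = D.dist f Φf},
      ∃ hF' : F' ∈ S.holSatU hV k 𝓕,
        S.clsU hHD hI h₁ h₃ hA 𝓕 hι hV k ⟨F', hF'⟩ ∈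
          ⨆ (χ : PontryaginDual (↥(relNormOneIdeles (↥(maximalRealSubfield L)) L) ⧸ relNormOneRat (↥(maximalRealSubfield L)) L))
            (_ : charInv χ ∈ 𝓕),
            ⨆ ψ : (D.coinvRep χ).asModule →ₗ[MonoidAlgebra ℂ ↥V.adelicFin] Tower hHD hI (ballQuotientUniformisedDatum_of h₁) h₃ hA V,
              (LinearMap.range ψ).restrictScalars ℂ := by
    intro F' hF'
    induction hF' using Submodule.span_induction with
    | mem F' hF' =>
      obtain ⟨f, hf, Φf, -, rfl⟩ := hF'
      obtain ⟨χ, rfl⟩ := h𝓕 f hf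
      obtain ⟨hF'', hcls⟩ := D.exists_mem_holSatU_clsU_mem_block hHD hI h₁ h₃ hA hGfin hLF hd hCR χ hf hι Φf
      exact ⟨hF'', Submodule.mem_iSup_of_mem χ (Submodule.mem_iSup_of_mem hf hcls)⟩
    | zero =>
      refine ⟨Submodule.zero_mem _, ?_⟩
      rw [show (⟨0, Submodule.zero_mem _⟩ : ↥(S.holSatU hV k 𝓕)) = 0 from rfl, map_zero]
      exact Submodule.zero_mem _
    | add F₁ F₂ _ _ h₁' h₂' =>
      obtain ⟨hF₁, hc₁⟩ := h₁'
      obtain ⟨hF₂, hc₂⟩ := h₂'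
      refine ⟨Submodule.add_mem _ hF₁ hF₂, ?_⟩
      rw [show (⟨F₁ + F₂, Submodule.add_mem _ hF₁ hF₂⟩ : ↥(S.holSatU hV k 𝓕)) = ⟨F₁, hF₁⟩ + ⟨F₂, hF₂⟩ from rfl, map_add]
      exact Submodule.add_mem _ hc₁ hc₂
    | smul r F' _ h' =>
      obtain ⟨hF', hc⟩ := h'
      refine ⟨Submodule.smul_mem _ r hF', ?_⟩
      rw [show (⟨r • F', Submodule.smul_mem _ r hF'⟩ : ↥(S.holSatU hV k 𝓕)) = r • ⟨F', hF'⟩ from rfl, map_smul]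
      exact Submodule.smul_mem _ r hc
  exact key F (D.adelicThetaSpanSat_le_span_dist ωar har hmult K 𝓕 hF)

include har hmult hGfin hLF hd hCR h𝓕 in
/-- The same for sinst-1's `holSat Γ` (#1242): every saturated hol-germ theta form at level `Γ` has its tower class in the sum of the blocks. -/
theorem clsU_mem_iSup_block_of_mem_holSat_of_multOne (hι : S.ιinf = archInfOf V) (Γ : Level V)
    {F : (V.latticeModel printFact_unitaryCompact_holds).G → (Fin 2 → ℂ)} (hF : F ∈ S.holSat hV k Γ 𝓕) :
    ∃ hF' : F ∈ S.holSatU hV k 𝓕,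
      S.clsU hHD hI h₁ h₃ hA 𝓕 hι hV k ⟨F, hF'⟩ ∈
        ⨆ (χ : PontryaginDual (↥(relNormOneIdeles (↥(maximalRealSubfield L)) L) ⧸ relNormOneRat (↥(maximalRealSubfield L)) L))
          (_ : charInv χ ∈ 𝓕),
          ⨆ ψ : (D.coinvRep χ).asModule →ₗ[MonoidAlgebra ℂ ↥V.adelicFin] Tower hHD hI (ballQuotientUniformisedDatum_of h₁) h₃ hA V,
            (LinearMap.range ψ).restrictScalars ℂ :=
  D.clsU_mem_iSup_block_of_mem_adelicThetaSpanSat_of_multOne hHD hI h₁ h₃ hA ωar har hmult hGfin hLF hd hCR h𝓕 hι Γ.K hF.1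

end ThetaDistDatum

/-! ### § 2. At the honest adelic side `archSideOf …`, slots 0 and 1 -/

section Honest

variable (hHD : exists_isReal_hodgeModel) (hI : hodgePQ_independent_of_hodgeModel)
  (h₁ : BallQuotientUniformised) (h₃ : CMAbelianVarietyRealised) (hA : Arapura2012_Cor_15_4_6)
variable {L : CMField} {ι₁ : L →+* ℂ} (V : HermSpace3 L ι₁) (c : SeesawCtx L)
  (hGR : (cmSplittingDatum (L : Type) finProdFinEquiv (frameD V) (frameD_real V) (frameD_ne V) (dW c.D) (dW_real c.D)
    (dW_ne c.D)).CompatibleSplitting)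
  (hGR₀ : (cmSplittingDatum (L : Type) (e₁) (frameD V) (frameD_real V) (frameD_ne V) (lineVec (L : Type) (dW c.D 0))
    (fun _ => dW_real c.D 0) (fun _ => dW_ne c.D 0)).CompatibleSplitting)
  (hGR₁ : (cmSplittingDatum (L : Type) (e₁) (frameD V) (frameD_real V) (frameD_ne V) (lineVec (L : Type) (dW c.D 1))
    (fun _ => dW_real c.D 1) (fun _ => dW_ne c.D 1)).CompatibleSplitting)
  (hGR₂ : (cmSplittingDatum (L : Type) (e₁) (frameD V) (frameD_real V) (frameD_ne V) (lineVec (L : Type) (dW' c.D 0))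
    (fun _ => dW'_real c.D 0) (fun _ => dW'_ne c.D 0)).CompatibleSplitting)
  (hGR₃ : (cmSplittingDatum (L : Type) (e₁) (frameD V) (frameD_real V) (frameD_ne V) (lineVec (L : Type) (dW' c.D 1))
    (fun _ => dW'_real c.D 1) (fun _ => dW'_ne c.D 1)).CompatibleSplitting)
  (η : CMAdelic (L : Type) (frameD V) × CMAdelic (L : Type) (dW c.D) →* ℂˣ)
  (hη : ∀ γU ∈ CMRat (L : Type) (frameD V), ∀ γ ∈ CMRat (L : Type) (dW c.D), η (γU, γ) = 1)
  (hηc : Continuous fun p => ((η p : ℂˣ) : ℂ))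
  (h₁W : (∀ j, 0 < (ι₁ (dW c.D j)).re) ∨ ∀ j, (ι₁ (dW c.D j)).re < 0)
  (A : ∀ k : Fin 4, ArchLineInput V (lineRepD V c.D hGR hGR₀ hGR₁ hGR₂ hGR₃ η k))
  (hV : IsAnisotropic L V.Hm)

/-- **The archimedean operators of slot 0** on `𝓢((L⁺ ⊗ ℝ)³)`: `aa ↦ c₀(aa′) • ω_∞(aa′, 1)`, `aa′ = archFrameCongr (frameG V) aa`
(carch's line scalar `archScalar_zeroG` times the archimedean Weil operator `cmArchWeilRep … hGR₀`). -/
def archOpZero (aa : UnitaryGroup.arch (↥(maximalRealSubfield L)) L (IsCMField.complexConj L) 3 V.Hm) :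
    𝓢((Fin 3 → mixedSpace (↥(maximalRealSubfield L))), ℂ) →ₗ[ℂ] 𝓢((Fin 3 → mixedSpace (↥(maximalRealSubfield L))), ℂ) :=
  ((archScalar_zeroG V c.D hGR hGR₀ hGR₁ (eta₀ V c.D η) (archFrameCongr (L : Type) V.Hm (frameG V) (frameD V) (frame_congr V) aa) : ℂˣ) :
      ℂ) •
    (cmArchWeilRep (L : Type) e₁ (frameD V) (frameD_real V) (frameD_ne V) (lineVec (L : Type) (dW c.D 0))
      (fun _ => dW_real c.D 0) (fun _ => dW_ne c.D 0) hGR₀ (archFrameCongr (L : Type) V.Hm (frameG V) (frameD V) (frame_congr V) aa, 1) :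
        𝓢((Fin 3 → mixedSpace (↥(maximalRealSubfield L))), ℂ) →ₗ[ℂ] _)

/-- **The archimedean operators of slot 1**: `aa ↦ c₁(aa′) • ω_∞(aa′, 1)` (`archScalar_oneG`, `cmArchWeilRep … hGR₁`). -/
def archOpOne (aa : UnitaryGroup.arch (↥(maximalRealSubfield L)) L (IsCMField.complexConj L) 3 V.Hm) :
    𝓢((Fin 3 → mixedSpace (↥(maximalRealSubfield L))), ℂ) →ₗ[ℂ] 𝓢((Fin 3 → mixedSpace (↥(maximalRealSubfield L))), ℂ) :=
  ((archScalar_oneG V c.D hGR hGR₀ hGR₁ (eta₁ V c.D η) (archFrameCongr (L : Type) V.Hm (frameG V) (frameD V) (frame_congr V) aa) : ℂˣ) :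
      ℂ) •
    (cmArchWeilRep (L : Type) e₁ (frameD V) (frameD_real V) (frameD_ne V) (lineVec (L : Type) (dW c.D 1))
      (fun _ => dW_real c.D 1) (fun _ => dW_ne c.D 1) hGR₁ (archFrameCongr (L : Type) V.Hm (frameG V) (frameD V) (frame_congr V) aa, 1) :
        𝓢((Fin 3 → mixedSpace (↥(maximalRealSubfield L))), ℂ) →ₗ[ℂ] _)

/-- **`har` of slot 0, DISCHARGED** (carch `lineRepOf_zero_regime_archToAdelicG`, for EVERY archimedean element). -/
theorem archSideOf_ω_zero_regime_archToAdelic (aa : UnitaryGroup.arch (↥(maximalRealSubfield L)) L (IsCMField.complexConj L) 3 V.Hm) :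
    ((archSideOf V c hGR hGR₀ hGR₁ hGR₂ hGR₃ η hη hηc h₁W A).P 0).ω
        (HodgeCM.Adelic.regimeEquiv L V.Hm hV
          (UnitaryGroup.archToAdelic (↥(maximalRealSubfield L)) L (IsCMField.complexConj L) 3 V.Hm aa), 1) =
      adelicTensorEnd (K := ↥(maximalRealSubfield L)) (ι := Fin 3) (archOpZero V c hGR hGR₀ hGR₁ η aa) LinearMap.id :=
  lineRepOf_zero_regime_archToAdelicG V c.D hGR hGR₀ hGR₁ hGR₂ hGR₃ (eta₀ V c.D η) (eta₁ V c.D η) (eta₂ V c.D η) (eta₃ V c.D η) hV aa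

/-- **`har` of slot 1, DISCHARGED** (carch `lineRepOf_one_regime_archToAdelicG`). -/
theorem archSideOf_ω_one_regime_archToAdelic (aa : UnitaryGroup.arch (↥(maximalRealSubfield L)) L (IsCMField.complexConj L) 3 V.Hm) :
    ((archSideOf V c hGR hGR₀ hGR₁ hGR₂ hGR₃ η hη hηc h₁W A).P 1).ω
        (HodgeCM.Adelic.regimeEquiv L V.Hm hV
          (UnitaryGroup.archToAdelic (↥(maximalRealSubfield L)) L (IsCMField.complexConj L) 3 V.Hm aa), 1) =
      adelicTensorEnd (K := ↥(maximalRealSubfield L)) (ι := Fin 3) (archOpOne V c hGR hGR₀ hGR₁ η aa) LinearMap.id :=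
  lineRepOf_one_regime_archToAdelicG V c.D hGR hGR₀ hGR₁ hGR₂ hGR₃ (eta₀ V c.D η) (eta₁ V c.D η) (eta₂ V c.D η) (eta₃ V c.D η) hV aa

section Slots

variable
  (Φ₀ : Module.Dual ℂ (Fin 2 → ℂ) →ₗ[ℂ] 𝓢((Fin 3 → mixedSpace (↥(maximalRealSubfield L))), ℂ))
  (harm₀ : ∀ (u : ↥(stabilizer U21 x₀)) (ℓ : Module.Dual ℂ (Fin 2 → ℂ)),
    lineOmega_zero V c.D hGR hGR₀ hGR₁ (eta₀ V c.D η) (u : U21) (Φ₀ ℓ) =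
      Φ₀ ((BallForms.isPullbackCocycle_cotangentCocycle.weightOf x₀).dual u ℓ))
  (hdef₀ : ∀ a : UnitaryGroup.arch (↥(maximalRealSubfield L)) L (IsCMField.complexConj L) 3 V.Hm,
    UnitaryGroup.archAt (↥(maximalRealSubfield L)) L (IsCMField.complexConj L) 3 V.Hm (UnitaryGroup.cmPlace (L : Type) ι₁)
        (NumberField.complexConj_smul_infinitePlace (L : Type) _) (IsCMField.complexConj_ne_one (L : Type)) a = 1 →
    ∀ (ℓ : Module.Dual ℂ (Fin 2 → ℂ)) (Φf : FinSB (↥(maximalRealSubfield L)) (Fin 3)),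
      lineRepOf V c.D hGR hGR₀ hGR₁ hGR₂ hGR₃ (eta₀ V c.D η) (eta₁ V c.D η) (eta₂ V c.D η) (eta₃ V c.D η) 0
          (HodgeCM.Adelic.regimeEquiv L V.Hm hV
            (UnitaryGroup.archToAdelic (↥(maximalRealSubfield L)) L (IsCMField.complexConj L) 3 V.Hm a), 1)
          (piSchwartzBruhatEquiv (↥(maximalRealSubfield L)) (Fin 3) (Φ₀ ℓ ⊗ₜ[ℂ] Φf)) =
        piSchwartzBruhatEquiv (↥(maximalRealSubfield L)) (Fin 3) (Φ₀ ℓ ⊗ₜ[ℂ] Φf))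
  (Φ₁ : Module.Dual ℂ (Fin 2 → ℂ) →ₗ[ℂ] 𝓢((Fin 3 → mixedSpace (↥(maximalRealSubfield L))), ℂ))
  (harm₁ : ∀ (u : ↥(stabilizer U21 x₀)) (ℓ : Module.Dual ℂ (Fin 2 → ℂ)),
    lineOmega_one V c.D hGR hGR₀ hGR₁ (eta₁ V c.D η) (u : U21) (Φ₁ ℓ) =
      Φ₁ ((BallForms.isPullbackCocycle_cotangentCocycle.weightOf x₀).dual u ℓ))
  (hdef₁ : ∀ a : UnitaryGroup.arch (↥(maximalRealSubfield L)) L (IsCMField.complexConj L) 3 V.Hm,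
    UnitaryGroup.archAt (↥(maximalRealSubfield L)) L (IsCMField.complexConj L) 3 V.Hm (UnitaryGroup.cmPlace (L : Type) ι₁)
        (NumberField.complexConj_smul_infinitePlace (L : Type) _) (IsCMField.complexConj_ne_one (L : Type)) a = 1 →
    ∀ (ℓ : Module.Dual ℂ (Fin 2 → ℂ)) (Φf : FinSB (↥(maximalRealSubfield L)) (Fin 3)),
      lineRepOf V c.D hGR hGR₀ hGR₁ hGR₂ hGR₃ (eta₀ V c.D η) (eta₁ V c.D η) (eta₂ V c.D η) (eta₃ V c.D η) 1
          (HodgeCM.Adelic.regimeEquiv L V.Hm hV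
            (UnitaryGroup.archToAdelic (↥(maximalRealSubfield L)) L (IsCMField.complexConj L) 3 V.Hm a), 1)
          (piSchwartzBruhatEquiv (↥(maximalRealSubfield L)) (Fin 3) (Φ₁ ℓ ⊗ₜ[ℂ] Φf)) =
        piSchwartzBruhatEquiv (↥(maximalRealSubfield L)) (Fin 3) (Φ₁ ℓ ⊗ₜ[ℂ] Φf))

/-- **Slot 0, single weight function**: modulo multiplicity one, EVERY element of `holSat Γ {f}` of slot 0 of the honest side IS
`(thetaDistDatumZeroOf …).dist f Φ_f` for one `Γ.K`-fixed finite test vector. -/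
theorem exists_eq_dist_of_mem_holSat_archSideOf_zero
    (hmult : ∀ a ∈ (thetaDistDatumZeroOf V c hGR hGR₀ hGR₁ hGR₂ hGR₃ η hη hηc h₁W A hV Φ₀ harm₀ hdef₀).admFamilies
      (archOpZero V c hGR hGR₀ hGR₁ η), ∃ r : ℂ, a = r • Φ₀)
    (Γ : Level V) (f : C(↥(relNormOneIdeles (↥(maximalRealSubfield L)) L) ⧸ relNormOneRat (↥(maximalRealSubfield L)) L, ℂ))
    {F : (V.latticeModel printFact_unitaryCompact_holds).G → (Fin 2 → ℂ)}
    (hF : F ∈ (archSideOf V c hGR hGR₀ hGR₁ hGR₂ hGR₃ η hη hηc h₁W A).holSat hV 0 Γ {f}) :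
    ∃ Φf : FinSB (↥(maximalRealSubfield L)) (Fin 3), (∀ g ∈ Γ.K, finRepZero V c.D hGR hGR₀ hGR₁ (eta₀ V c.D η) (g, 1) Φf = Φf) ∧
      F = (thetaDistDatumZeroOf V c hGR hGR₀ hGR₁ hGR₂ hGR₃ η hη hηc h₁W A hV Φ₀ harm₀ hdef₀).dist f Φf :=
  (thetaDistDatumZeroOf V c hGR hGR₀ hGR₁ hGR₂ hGR₃ η hη hηc h₁W A hV Φ₀ harm₀ hdef₀).exists_eq_dist_of_mem_holSat
    (archOpZero V c hGR hGR₀ hGR₁ η)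
    (fun aa _ => archSideOf_ω_zero_regime_archToAdelic V c hGR hGR₀ hGR₁ hGR₂ hGR₃ η hη hηc h₁W A hV aa) hmult Γ f hF

/-- **Slot 1, single weight function.** -/
theorem exists_eq_dist_of_mem_holSat_archSideOf_one
    (hmult : ∀ a ∈ (thetaDistDatumOneOf V c hGR hGR₀ hGR₁ hGR₂ hGR₃ η hη hηc h₁W A hV Φ₁ harm₁ hdef₁).admFamilies
      (archOpOne V c hGR hGR₀ hGR₁ η), ∃ r : ℂ, a = r • Φ₁)
    (Γ : Level V) (f : C(↥(relNormOneIdeles (↥(maximalRealSubfield L)) L) ⧸ relNormOneRat (↥(maximalRealSubfield L)) L, ℂ))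
    {F : (V.latticeModel printFact_unitaryCompact_holds).G → (Fin 2 → ℂ)}
    (hF : F ∈ (archSideOf V c hGR hGR₀ hGR₁ hGR₂ hGR₃ η hη hηc h₁W A).holSat hV 1 Γ {f}) :
    ∃ Φf : FinSB (↥(maximalRealSubfield L)) (Fin 3), (∀ g ∈ Γ.K, finRepOne V c.D hGR hGR₀ hGR₁ (eta₁ V c.D η) (g, 1) Φf = Φf) ∧
      F = (thetaDistDatumOneOf V c hGR hGR₀ hGR₁ hGR₂ hGR₃ η hη hηc h₁W A hV Φ₁ harm₁ hdef₁).dist f Φf :=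
  (thetaDistDatumOneOf V c hGR hGR₀ hGR₁ hGR₂ hGR₃ η hη hηc h₁W A hV Φ₁ harm₁ hdef₁).exists_eq_dist_of_mem_holSat
    (archOpOne V c hGR hGR₀ hGR₁ η)
    (fun aa _ => archSideOf_ω_one_regime_archToAdelic V c hGR hGR₀ hGR₁ hGR₂ hGR₃ η hη hηc h₁W A hV aa) hmult Γ f hF

variable
  (hd₀ : ∀ (T : 𝓢((Fin 3 → mixedSpace (↥(maximalRealSubfield L))), ℂ) →L[ℂ] ℂ) (ℓ : Module.Dual ℂ (Fin 2 → ℂ)),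
    DifferentiableAt ℝ (fun b => T (lineOmega_zero V c.D hGR hGR₀ hGR₁ (eta₀ V c.D η) (BallForms.expP b) (Φ₀ ℓ))) 0)
  (hCR₀ : ∀ (T : 𝓢((Fin 3 → mixedSpace (↥(maximalRealSubfield L))), ℂ) →L[ℂ] ℂ) (ℓ : Module.Dual ℂ (Fin 2 → ℂ)) (v : Fin 2 → ℂ),
    fderiv ℝ (fun b => T (lineOmega_zero V c.D hGR hGR₀ hGR₁ (eta₀ V c.D η) (BallForms.expP b) (Φ₀ ℓ))) 0 (Complex.I • v) =
      Complex.I • fderiv ℝ (fun b => T (lineOmega_zero V c.D hGR hGR₀ hGR₁ (eta₀ V c.D η) (BallForms.expP b) (Φ₀ ℓ))) 0 v)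
  (hd₁ : ∀ (T : 𝓢((Fin 3 → mixedSpace (↥(maximalRealSubfield L))), ℂ) →L[ℂ] ℂ) (ℓ : Module.Dual ℂ (Fin 2 → ℂ)),
    DifferentiableAt ℝ (fun b => T (lineOmega_one V c.D hGR hGR₀ hGR₁ (eta₁ V c.D η) (BallForms.expP b) (Φ₁ ℓ))) 0)
  (hCR₁ : ∀ (T : 𝓢((Fin 3 → mixedSpace (↥(maximalRealSubfield L))), ℂ) →L[ℂ] ℂ) (ℓ : Module.Dual ℂ (Fin 2 → ℂ)) (v : Fin 2 → ℂ),
    fderiv ℝ (fun b => T (lineOmega_one V c.D hGR hGR₀ hGR₁ (eta₁ V c.D η) (BallForms.expP b) (Φ₁ ℓ))) 0 (Complex.I • v) =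
      Complex.I • fderiv ℝ (fun b => T (lineOmega_one V c.D hGR hGR₀ hGR₁ (eta₁ V c.D η) (BallForms.expP b) (Φ₁ ℓ))) 0 v)
  {𝓕 : Set C(↥(relNormOneIdeles (↥(maximalRealSubfield L)) L) ⧸ relNormOneRat (↥(maximalRealSubfield L)) L, ℂ)}
  (h𝓕 : ∀ f ∈ 𝓕, ∃ χ : PontryaginDual (↥(relNormOneIdeles (↥(maximalRealSubfield L)) L) ⧸ relNormOneRat (↥(maximalRealSubfield L)) L),
    f = charInv χ)

include hd₀ hCR₀ h𝓕 in
/-- **`hfam` clause 2 for EVERY saturated hol-germ theta form of slot 0 of the honest side, modulo multiplicity one** (family form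
`hmult`): for weight functions `𝓕 ⊆ {charInv χ}` and every `F ∈ holSat Γ 𝓕` of slot 0 of `archSideOf …`, `F ∈ holSatU` and its tower class
lies in `⨆_{χ, charInv χ ∈ 𝓕} block(Ω(χ))`, `Ω(χ) = ((thetaDistDatumZeroOf …).coinvRep χ).asModule`. -/
theorem clsU_mem_iSup_block_of_mem_holSat_archSideOf_zero
    (hmult : ∀ a ∈ (thetaDistDatumZeroOf V c hGR hGR₀ hGR₁ hGR₂ hGR₃ η hη hηc h₁W A hV Φ₀ harm₀ hdef₀).admFamilies
      (archOpZero V c hGR hGR₀ hGR₁ η), ∃ r : ℂ, a = r • Φ₀)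
    (hι : (archSideOf V c hGR hGR₀ hGR₁ hGR₂ hGR₃ η hη hηc h₁W A).ιinf = archInfOf V) (Γ : Level V)
    {F : (V.latticeModel printFact_unitaryCompact_holds).G → (Fin 2 → ℂ)}
    (hF : F ∈ (archSideOf V c hGR hGR₀ hGR₁ hGR₂ hGR₃ η hη hηc h₁W A).holSat hV 0 Γ 𝓕) :
    ∃ hF' : F ∈ (archSideOf V c hGR hGR₀ hGR₁ hGR₂ hGR₃ η hη hηc h₁W A).holSatU hV 0 𝓕,
      (archSideOf V c hGR hGR₀ hGR₁ hGR₂ hGR₃ η hη hηc h₁W A).clsU hHD hI h₁ h₃ hA 𝓕 hι hV 0 ⟨F, hF'⟩ ∈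
        ⨆ (χ : PontryaginDual (↥(relNormOneIdeles (↥(maximalRealSubfield L)) L) ⧸ relNormOneRat (↥(maximalRealSubfield L)) L))
          (_ : charInv χ ∈ 𝓕),
          ⨆ ψ : ((thetaDistDatumZeroOf V c hGR hGR₀ hGR₁ hGR₂ hGR₃ η hη hηc h₁W A hV Φ₀ harm₀ hdef₀).coinvRep χ).asModule
              →ₗ[MonoidAlgebra ℂ ↥V.adelicFin] Tower hHD hI (ballQuotientUniformisedDatum_of h₁) h₃ hA V,
            (LinearMap.range ψ).restrictScalars ℂ :=
  (thetaDistDatumZeroOf V c hGR hGR₀ hGR₁ hGR₂ hGR₃ η hη hηc h₁W A hV Φ₀ harm₀ hdef₀).clsU_mem_iSup_block_of_mem_holSat_of_multOne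
    hHD hI h₁ h₃ hA (archOpZero V c hGR hGR₀ hGR₁ η)
    (fun aa _ => archSideOf_ω_zero_regime_archToAdelic V c hGR hGR₀ hGR₁ hGR₂ hGR₃ η hη hηc h₁W A hV aa) hmult
    (satG_le_archSideOf_Gfin V c hGR hGR₀ hGR₁ hGR₂ hGR₃ η hη hηc h₁W A hV)
    (isLFAction_archSideOf V c hGR hGR₀ hGR₁ hGR₂ hGR₃ η hη hηc h₁W A 0) hd₀ hCR₀ h𝓕 hι Γ hF

include hd₁ hCR₁ h𝓕 in
/-- **`hfam` clause 2 for EVERY saturated hol-germ theta form of slot 1 of the honest side, modulo multiplicity one.** -/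
theorem clsU_mem_iSup_block_of_mem_holSat_archSideOf_one
    (hmult : ∀ a ∈ (thetaDistDatumOneOf V c hGR hGR₀ hGR₁ hGR₂ hGR₃ η hη hηc h₁W A hV Φ₁ harm₁ hdef₁).admFamilies
      (archOpOne V c hGR hGR₀ hGR₁ η), ∃ r : ℂ, a = r • Φ₁)
    (hι : (archSideOf V c hGR hGR₀ hGR₁ hGR₂ hGR₃ η hη hηc h₁W A).ιinf = archInfOf V) (Γ : Level V)
    {F : (V.latticeModel printFact_unitaryCompact_holds).G → (Fin 2 → ℂ)}
    (hF : F ∈ (archSideOf V c hGR hGR₀ hGR₁ hGR₂ hGR₃ η hη hηc h₁W A).holSat hV 1 Γ 𝓕) :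
    ∃ hF' : F ∈ (archSideOf V c hGR hGR₀ hGR₁ hGR₂ hGR₃ η hη hηc h₁W A).holSatU hV 1 𝓕,
      (archSideOf V c hGR hGR₀ hGR₁ hGR₂ hGR₃ η hη hηc h₁W A).clsU hHD hI h₁ h₃ hA 𝓕 hι hV 1 ⟨F, hF'⟩ ∈
        ⨆ (χ : PontryaginDual (↥(relNormOneIdeles (↥(maximalRealSubfield L)) L) ⧸ relNormOneRat (↥(maximalRealSubfield L)) L))
          (_ : charInv χ ∈ 𝓕),
          ⨆ ψ : ((thetaDistDatumOneOf V c hGR hGR₀ hGR₁ hGR₂ hGR₃ η hη hηc h₁W A hV Φ₁ harm₁ hdef₁).coinvRep χ).asModule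
              →ₗ[MonoidAlgebra ℂ ↥V.adelicFin] Tower hHD hI (ballQuotientUniformisedDatum_of h₁) h₃ hA V,
            (LinearMap.range ψ).restrictScalars ℂ :=
  (thetaDistDatumOneOf V c hGR hGR₀ hGR₁ hGR₂ hGR₃ η hη hηc h₁W A hV Φ₁ harm₁ hdef₁).clsU_mem_iSup_block_of_mem_holSat_of_multOne
    hHD hI h₁ h₃ hA (archOpOne V c hGR hGR₀ hGR₁ η)
    (fun aa _ => archSideOf_ω_one_regime_archToAdelic V c hGR hGR₀ hGR₁ hGR₂ hGR₃ η hη hηc h₁W A hV aa) hmult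
    (satG_le_archSideOf_Gfin V c hGR hGR₀ hGR₁ hGR₂ hGR₃ η hη hηc h₁W A hV)
    (isLFAction_archSideOf V c hGR hGR₀ hGR₁ hGR₂ hGR₃ η hη hηc h₁W A 1) hd₁ hCR₁ h𝓕 hι Γ hF

include hd₀ hCR₀ h𝓕 in
/-- The same for slot 0 with the multiplicity-one input in RANK form (`Module.rank ℂ ↥(admFamilies …) ≤ 1`) and `Φarch ≠ 0`. -/
theorem clsU_mem_iSup_block_of_mem_holSat_archSideOf_zero_of_rank_le_one (hΦ : Φ₀ ≠ 0)
    (hrk : Module.rank ℂ ↥((thetaDistDatumZeroOf V c hGR hGR₀ hGR₁ hGR₂ hGR₃ η hη hηc h₁W A hV Φ₀ harm₀ hdef₀).admFamilies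
      (archOpZero V c hGR hGR₀ hGR₁ η)) ≤ 1)
    (hι : (archSideOf V c hGR hGR₀ hGR₁ hGR₂ hGR₃ η hη hηc h₁W A).ιinf = archInfOf V) (Γ : Level V)
    {F : (V.latticeModel printFact_unitaryCompact_holds).G → (Fin 2 → ℂ)}
    (hF : F ∈ (archSideOf V c hGR hGR₀ hGR₁ hGR₂ hGR₃ η hη hηc h₁W A).holSat hV 0 Γ 𝓕) :
    ∃ hF' : F ∈ (archSideOf V c hGR hGR₀ hGR₁ hGR₂ hGR₃ η hη hηc h₁W A).holSatU hV 0 𝓕,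
      (archSideOf V c hGR hGR₀ hGR₁ hGR₂ hGR₃ η hη hηc h₁W A).clsU hHD hI h₁ h₃ hA 𝓕 hι hV 0 ⟨F, hF'⟩ ∈
        ⨆ (χ : PontryaginDual (↥(relNormOneIdeles (↥(maximalRealSubfield L)) L) ⧸ relNormOneRat (↥(maximalRealSubfield L)) L))
          (_ : charInv χ ∈ 𝓕),
          ⨆ ψ : ((thetaDistDatumZeroOf V c hGR hGR₀ hGR₁ hGR₂ hGR₃ η hη hηc h₁W A hV Φ₀ harm₀ hdef₀).coinvRep χ).asModule
              →ₗ[MonoidAlgebra ℂ ↥V.adelicFin] Tower hHD hI (ballQuotientUniformisedDatum_of h₁) h₃ hA V,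
            (LinearMap.range ψ).restrictScalars ℂ :=
  clsU_mem_iSup_block_of_mem_holSat_archSideOf_zero hHD hI h₁ h₃ hA V c hGR hGR₀ hGR₁ hGR₂ hGR₃ η hη hηc h₁W A hV Φ₀ harm₀ hdef₀ hd₀ hCR₀ h𝓕
    ((thetaDistDatumZeroOf V c hGR hGR₀ hGR₁ hGR₂ hGR₃ η hη hηc h₁W A hV Φ₀ harm₀ hdef₀).multOne_of_rank_le_one
      (archOpZero V c hGR hGR₀ hGR₁ η)
      (fun aa _ => archSideOf_ω_zero_regime_archToAdelic V c hGR hGR₀ hGR₁ hGR₂ hGR₃ η hη hηc h₁W A hV aa) hΦ hrk) hι Γ hF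

include hd₁ hCR₁ h𝓕 in
/-- The same for slot 1 with the multiplicity-one input in RANK form. -/
theorem clsU_mem_iSup_block_of_mem_holSat_archSideOf_one_of_rank_le_one (hΦ : Φ₁ ≠ 0)
    (hrk : Module.rank ℂ ↥((thetaDistDatumOneOf V c hGR hGR₀ hGR₁ hGR₂ hGR₃ η hη hηc h₁W A hV Φ₁ harm₁ hdef₁).admFamilies
      (archOpOne V c hGR hGR₀ hGR₁ η)) ≤ 1)
    (hι : (archSideOf V c hGR hGR₀ hGR₁ hGR₂ hGR₃ η hη hηc h₁W A).ιinf = archInfOf V) (Γ : Level V)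
    {F : (V.latticeModel printFact_unitaryCompact_holds).G → (Fin 2 → ℂ)}
    (hF : F ∈ (archSideOf V c hGR hGR₀ hGR₁ hGR₂ hGR₃ η hη hηc h₁W A).holSat hV 1 Γ 𝓕) :
    ∃ hF' : F ∈ (archSideOf V c hGR hGR₀ hGR₁ hGR₂ hGR₃ η hη hηc h₁W A).holSatU hV 1 𝓕,
      (archSideOf V c hGR hGR₀ hGR₁ hGR₂ hGR₃ η hη hηc h₁W A).clsU hHD hI h₁ h₃ hA 𝓕 hι hV 1 ⟨F, hF'⟩ ∈
        ⨆ (χ : PontryaginDual (↥(relNormOneIdeles (↥(maximalRealSubfield L)) L) ⧸ relNormOneRat (↥(maximalRealSubfield L)) L))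
          (_ : charInv χ ∈ 𝓕),
          ⨆ ψ : ((thetaDistDatumOneOf V c hGR hGR₀ hGR₁ hGR₂ hGR₃ η hη hηc h₁W A hV Φ₁ harm₁ hdef₁).coinvRep χ).asModule
              →ₗ[MonoidAlgebra ℂ ↥V.adelicFin] Tower hHD hI (ballQuotientUniformisedDatum_of h₁) h₃ hA V,
            (LinearMap.range ψ).restrictScalars ℂ :=
  clsU_mem_iSup_block_of_mem_holSat_archSideOf_one hHD hI h₁ h₃ hA V c hGR hGR₀ hGR₁ hGR₂ hGR₃ η hη hηc h₁W A hV Φ₁ harm₁ hdef₁ hd₁ hCR₁ h𝓕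
    ((thetaDistDatumOneOf V c hGR hGR₀ hGR₁ hGR₂ hGR₃ η hη hηc h₁W A hV Φ₁ harm₁ hdef₁).multOne_of_rank_le_one
      (archOpOne V c hGR hGR₀ hGR₁ η)
      (fun aa _ => archSideOf_ω_one_regime_archToAdelic V c hGR hGR₀ hGR₁ hGR₂ hGR₃ η hη hηc h₁W A hV aa) hΦ hrk) hι Γ hF

end Slots

end Honest

end ThetaAdelicSide
end HodgeCM.Model

end
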